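import Mathlib
import HarnessLib

/-!
# Burgess bounds for short character sums with a linear phase ("mixed" sums) — Heath-Brown–Pierce 2015

Topic `Literature/NumberTheory/GaussSums`.  **Source.** D. R. Heath-Brown, L. B. Pierce, *Burgess bounds
for short mixed character sums*, J. Lond. Math. Soc. (2) 91 (2015) 693–708 (arXiv:1404.1677), Theorem 1.4
(earlier: Burgess 1988 for rational phases `a/q`; Friedlander–Iwaniec 1993; Chang 2010 for polynomial
phases).

**Statement (named fact, unproved in the tree).** `BurgessBoundLinearPhase`: for every `r ≥ 2`, `ε > 0`
there is `C(r, ε)` with `|Σ_{N<n≤N+H} e(θn) χ(n)| ≤ C · H^{1−1/r} · q^{1/(4(r−1))+ε}` for every prime `q`,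
every non-principal multiplicative character `χ` mod `q`, every real `θ`, every integer `N` and every
`H < q^{1/2+1/(4(r−1))}`.  The constant is uniform in `θ` (the proof, §2 of the source, bounds the supremum
over all real phases of the given degree).  Non-trivial once `H > q^{1/4+ε}`; at `H ≍ q^{1/2}` with `r = 3`
it saves `q^{1/24−o(1)}` over the Pólya–Vinogradov / completion bound `√q`.

**Used by.** `Summits/ValiantsHypothesis/ValiantsHypothesis/Theorems/FeketeSOSFeketeSOSHardPaleyRIPBurgessRange.lean`
(`flatRIP_progression_of_burgessBoundLinearPhase`: the restricted-isometry / flat-discrepancy inequality for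
the Paley–Hankel matrix `(χ_p(a+b))` on supports inside a short arithmetic progression, via the Hankel
symbol bound of `…PaleyRIPHankelFourier.lean`).  Discharging this fact needs the Burgess method (Weil's bound
for complete character sums of polynomials + amplification over auxiliary primes), not in Mathlib.

(File created by accept-time relocation of the `[cite]`d proposition from the Summits proposal p592516;
docstring tidied by the author, statement unchanged.)
-/

namespace Literature.NumberTheory.GaussSums

open Finset Complex
open scoped BigOperators ZMod Real

/-- **Burgess bound for short character sums with a linear phase** (D. R. Heath-Brown and L. B. Pierce,
*Burgess bounds for short mixed character sums*, J. Lond. Math. Soc. (2) 91 (2015) 693–708, Theorem 1.4;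
the case `θ = a/q` is Burgess 1988, and real linear phases are also covered by Friedlander–Iwaniec 1993
and Chang 2010).  For every integer `r ≥ 2` and every `ε > 0` there is a constant `C = C(r, ε) > 0` such
that for every prime `q`, every non-principal multiplicative character `χ` modulo `q` (extended by `0`),
every real `θ`, every integer `N` and every natural number `H < q^{1/2 + 1/(4(r−1))}`,
`|Σ_{N < n ≤ N+H} e(θn) χ(n)| ≤ C · H^{1−1/r} · q^{1/(4(r−1)) + ε}`, where `e(t) = exp(2πit)`.
(The source states `≪_{r,ε} H^{1−1/r} q^{1/(4(r−1))+ε}` uniformly in `N` for any real LINEAR polynomial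
`f(n) = θn + θ₀`; the unimodular constant `e(θ₀)` is dropped here.  Non-trivial once `H > q^{1/4+ε}`;
with `r = 3` it saves `q^{1/24−o(1)}` over `√q` at `H ≍ √q`.)
[cite: HeathBrownPierce2015, Thm 1.4] [file NumberTheory/GaussSums/BurgessMixedCharacterSums] -/
def BurgessBoundLinearPhase : Prop :=
  ∀ r : ℕ, 2 ≤ r → ∀ ε : ℝ, 0 < ε → ∃ C : ℝ, 0 < C ∧
    ∀ (q : ℕ) [Fact q.Prime] (χ : MulChar (ZMod q) ℂ), χ ≠ 1 →
      ∀ (θ : ℝ) (N : ℤ) (H : ℕ), (H : ℝ) < (q : ℝ) ^ (1 / 2 + 1 / (4 * ((r : ℝ) - 1))) →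
        ‖∑ n ∈ Finset.Ioc N (N + H), Complex.exp (2 * π * I * θ * n) * χ (n : ZMod q)‖ ≤
          C * (H : ℝ) ^ (1 - 1 / (r : ℝ)) * (q : ℝ) ^ (1 / (4 * ((r : ℝ) - 1)) + ε)

end Literature.NumberTheory.GaussSums
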